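import Literature.AlgebraicGeometry.Motives.HodgeStructureEndActionCommutantFactorMatrixAlgebras
import HarnessLib

/-!
# THE CENTRE OF THE COMMUTANT `C_K(F) = C₁ × ⋯ × C_t` IS `F ⊗_ℚ K = F₁ × ⋯ × F_t`, AND THE BICOMMUTANT OF `F` ON `K ⊗ V` IS
# `F ⊗_ℚ K` (the double centralizer theorem for the action of `F`), FOR EVERY FIELD `K ⊇ ℚ`; `C_K(F) = F ⊗ K` EXACTLY WHEN
# `dim_F V ≤ 1` (Milne 1999 §2 p. 646, Remark 2.3 and type I p. 648)

[topic AlgebraicGeometry/Motives]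

Layer `Literature/AlgebraicGeometry/Motives`, lane `lit-hodgefound` (Track 2 foundations library; prover seat
`lit-hodgefound-p02`, generation 57, self-proposed row g57-#7; sequel of g57-#5
`Motives/HodgeStructureEndActionCommutantFactorMatrixAlgebras` (`Θ : C_K(F) ≅ ∏_𝔪 M_d(F_𝔪)`, `Θ(ι_K u) = (ū_𝔪 · 1)_𝔪`) and of
g56-#14 `Motives/HodgeStructureEndActionCommutantMatrixAlgebra` (`dim_K C_K(F) = d²·[F:ℚ]`)). THEOREMS ONLY: no definition, no
named fact (net debt `0`), no instance, no notation.

Milne, Remark 2.3 (p. 648): «Consider the abstract situation: `k` is a field, `E` is a simple `k`-algebra with centre a field `K` of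
finite degree over `k`, and `V` is a left `E`-module. Then the centralizer `C(E)` of `E` in `End_k(V)` is equal to its centralizer
in `End_K(V)`, and the canonical homomorphism `E ⊗_K C(E) → End_K(V)` is an isomorphism. … `C(E) ≈ M_t(Δ)`»; type I (p. 648):
«`C(A) = C₁ × ⋯ × C_t`, `Cᵢ = End_{Fᵢ}(Vᵢ) ≈ M_{2g/f}(Fᵢ)`». For the commutative algebra `E = F ⊗_ℚ k = ∏ᵢ Fᵢ` acting on
`V ⊗ k` this says: the centre of `C(F) = ∏ᵢ M_{d}(Fᵢ)` is `∏ᵢ Fᵢ = F ⊗ k` (the centre of a full matrix algebra over a field is the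
scalars), i.e. **the bicommutant of `F` is `F ⊗ k`** — the double centralizer theorem for the semisimple commutative subalgebra
`F ⊗ k ⊆ End_k(V ⊗ k)`. On the tree's carrier (`A : EndAction H F`, ANY field `K ⊇ ℚ`, `ι_K = baseChangeAction K A.ι :
K ⊗_ℚ F →ₐ[K] End_K(K ⊗_ℚ V)`, `C_K(F) = Subalgebra.centralizer K (range ι_K)`, `d·[F:ℚ] = dim_ℚ V`) we PROVE:
(i) `ι_K(u)` is central in `C_K(F)`; **`γ ∈ Z(C_K(F)) ⟺ γ = ι_K(u)` for some `u ∈ K ⊗_ℚ F`**, i.e. **`Z(C_K(F)) = ι_K(K ⊗_ℚ F)`**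
(through `Θ`: a central family of matrices is a family of scalars `(c_𝔪 · 1)_𝔪`, and `u ↦ (ū_𝔪)_𝔪` is onto by the Chinese
remainder theorem `K ⊗ F ≅ ∏_𝔪 F_𝔪`);
(ii) **the bicommutant `C_K(C_K(F)) = ι_K(K ⊗_ℚ F)`** (`ι_K(K ⊗ F) ⊆ C_K(F)` is commutative, so `C_K(C_K(F)) ⊆ C_K(F)` is the
centre of `C_K(F)`);
(iii) for `V ≠ 0` (`ι_K` injective, g56-#13): `dim_K ι_K(K ⊗ F) = dim_K Z(C_K(F)) = dim_K C_K(C_K(F)) = [F:ℚ]`;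
(iv) **`C_K(F) = ι_K(K ⊗_ℚ F)` (the commutant of `F` is `F ⊗ K` itself, i.e. `C_K(F)` is commutative) `⟺ dim_ℚ V ≤ [F:ℚ]`**
(`⟺ d ≤ 1`: `dim_K C_K(F) = d²[F:ℚ]` against `[F:ℚ]`) — for abelian varieties of type I `d = 2g/f ≥ 2` and `C(A)` is never
commutative, while `d = 1` is the case of a Hodge structure with complex multiplication by `F`.

## The source, verbatim

J. S. Milne, *Lefschetz classes on abelian varieties*, Duke Math. J. **96** (1999) 639–675 [Milne1999LefschetzClasses] (held
`paper:doi-10-1215-s0012-7094-99-09620-5`; Duke page = folio + 638). §2 p. 646 (p0008) L43–L50: «Let `F ⊗_ℚ k = F₁ × ⋯ × F_t`,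
be the decomposition of `F ⊗_ℚ k` into a product of fields … Any `k`-linear map `α : V → V` commuting with the action of `F`
decomposes into `α = α₁ ⊕ ⋯ ⊕ α_t`, `αᵢ : Vᵢ → Vᵢ`, `Fᵢ`-linear.»; Remark 2.3 p. 648 (p0010) L7–L18: «Consider the abstract
situation: `k` is a field, `E` is a simple `k`-algebra with centre a field `K` of finite degree over `k`, and `V` is a left
`E`-module. Then the centralizer `C(E)` of `E` in `End_k(V)` is equal to its centralizer in `End_K(V)`, and the canonical
homomorphism `E ⊗_K C(E) → End_K(V)` is an isomorphism. … `E ≈ M_r(Δ^opp) ⟹ C(E) ≈ M_t(Δ)`, `t = dim_K(V)/(r[Δ:K])`.»;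
p. 648 L42–L52: «Therefore, `C(A) = C₁ × ⋯ × C_t`, `Cᵢ = End_{Fᵢ}(Vᵢ) ≈ M_{2g/f}(Fᵢ)`».
The centre of a matrix algebra over a commutative ring is the scalars: Mathlib `Matrix.center_eq_range` [folklore].

## What is PROVED (namespace `Literature.AlgebraicGeometry.Motives.HodgeStructure.EndAction`)

* **`baseChangeAction_mem_center_centralizer`** (`ι_K(u) ∈ Z(C_K(F))`), **`range_baseChangeAction_le_centralizer`**.
* **`mem_center_centralizer_range_iff`**: `γ ∈ Z(C_K(F)) ⟺ ∃ u, γ = ι_K(u)`; **`map_val_center_centralizer_range_eq`**: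
  `Z(C_K(F)) = ι_K(K ⊗_ℚ F)` as subalgebras of `End_K(K ⊗ V)`.
* **`centralizer_centralizer_range_le`** (`C_K(C_K(F)) ≤ C_K(F)`), **`mem_centralizer_centralizer_range_iff`**,
  **`centralizer_centralizer_range_baseChangeAction_eq`**: THE BICOMMUTANT `C_K(C_K(F)) = ι_K(K ⊗_ℚ F)`.
* `V ≠ 0`: **`finrank_range_baseChangeAction_algHom`**, **`finrank_center_centralizer_range`**,
  **`finrank_centralizer_centralizer_range`** (all `= [F:ℚ]`).
* **`centralizer_range_eq_range_iff_finrank_le`**: `C_K(F) = ι_K(K ⊗_ℚ F) ⟺ dim_ℚ V ≤ [F:ℚ]`, with the two directions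
  **`centralizer_range_eq_range_of_finrank_le`**, **`finrank_le_of_centralizer_range_eq_range`**.

NOT here: the centre / bicommutant for the full endomorphism algebra `E ⊗ K` of types II–IV (the tree's
`HodgeStructure.centralizer_centralizer_endAlg_baseChange_eq_adjoin` treats `E_φ` of a polarizable `H`); the involution.

Nearest tree results, BY NAME: g57-#5 `EndAction.exists_algEquiv_centralizer_pi_matrix_quotient`; g56-#14
`finrank_centralizer_range_baseChangeAction`, `mem_centralizer_range_baseChangeAction_iff`; g56-#13 `baseChangeAction_injective`,
`isReduced_baseChange_numberField`, `finrank_field_dvd_finrank`; `HodgeGroupEnvelopingAlgebraPoints` (bicommutant of `Hg(H)(K)`,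
a different algebra); Mathlib `Matrix.center_eq_range`, `Set.center_pi`, `IsArtinianRing.equivPi`, `Subalgebra.eq_of_le_of_finrank_eq`.

## References

* [Milne1999LefschetzClasses] J. S. Milne, *Lefschetz classes on abelian varieties*, Duke Math. J. 96 (1999) 639–675, §2
  p. 646 L43–L50, Remark 2.3 p. 648 L7–L18, p. 648 L42–L52.
-/

noncomputable section

open scoped TensorProduct

namespace Literature.AlgebraicGeometry.Motives

/-! ## §0 Two algebra lemmas: centres are transported by algebra isomorphisms; the centre of `∏ᵢ M_d(Rᵢ)` -/

/-- The centre is transported by an algebra isomorphism. [folklore] -/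
private theorem mem_center_iff_map_mem_center₅₇₇ {K B B' : Type*} [CommSemiring K] [Semiring B] [Semiring B']
    [Algebra K B] [Algebra K B'] (Θ : B ≃ₐ[K] B') (z : B) :
    z ∈ Subalgebra.center K B ↔ Θ z ∈ Subalgebra.center K B' := by
  simp only [Subalgebra.mem_center_iff]
  refine ⟨fun h b' => ?_, fun h b => Θ.injective ?_⟩
  · obtain ⟨b, rfl⟩ := Θ.surjective b'
    rw [← map_mul, ← map_mul, h b]
  · rw [map_mul, map_mul, h (Θ b)]

/-- The centre of `∏ᵢ M_d(Rᵢ)`, `Rᵢ` commutative: the families of scalar matrices `(cᵢ · 1)ᵢ` (the centre of a product is the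
product of the centres, and the centre of `M_d(R)` is `R · 1`). [folklore] -/
private theorem mem_center_pi_matrix_iff₅₇₇ {ι K : Type*} [CommSemiring K] {R : ι → Type*} [∀ i, CommRing (R i)]
    [∀ i, Algebra K (R i)] {d : ℕ} (N : Π i, Matrix (Fin d) (Fin d) (R i)) :
    N ∈ Subalgebra.center K (Π i, Matrix (Fin d) (Fin d) (R i)) ↔
      ∀ i, ∃ c : R i, N i = c • (1 : Matrix (Fin d) (Fin d) (R i)) := by
  change N ∈ Set.center (Π i, Matrix (Fin d) (Fin d) (R i)) ↔ _
  rw [Set.center_pi, Set.mem_univ_pi]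
  refine forall_congr' fun i => ?_
  rw [Matrix.center_eq_range, Set.mem_range]
  refine exists_congr fun c => ?_
  rw [Matrix.scalar_apply, ← Matrix.smul_one_eq_diagonal, eq_comm]

namespace HodgeStructure

namespace EndAction

universe v uK

variable {V : Type v} [AddCommGroup V] [Module ℚ V] {n : ℤ} {H : HodgeStructure V n}
variable {F : Type*} [Field F] [NumberField F]
variable (K : Type uK) [Field K] [Algebra ℚ K] (A : EndAction H F)

/-! ## §1 `ι_K(K ⊗ F) ⊆ Z(C_K(F))` -/

/-- **`ι_K(u)` IS CENTRAL IN THE COMMUTANT `C_K(F)`**: every `γ ∈ C_K(F)` commutes with `ι_K(u)` by the definition of `C_K(F)`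
(«`αᵢ : Vᵢ → Vᵢ`, `Fᵢ`-linear»). [cite: Milne1999LefschetzClasses, §2 p. 646 L43–L50] -/
theorem baseChangeAction_mem_center_centralizer (u : K ⊗[ℚ] F) :
    (⟨baseChangeAction K A.ι u, A.baseChangeAction_mem_centralizer_range K u⟩ :
        Subalgebra.centralizer K (Set.range (baseChangeAction K A.ι))) ∈
      Subalgebra.center K (Subalgebra.centralizer K (Set.range (baseChangeAction K A.ι))) := by
  rw [Subalgebra.mem_center_iff]
  rintro ⟨γ, hγ⟩
  exact Subtype.ext ((Subalgebra.mem_centralizer_iff K).1 hγ _ ⟨u, rfl⟩).symm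

/-- **`ι_K(K ⊗_ℚ F) ⊆ C_K(F)`** (`K ⊗ F` is commutative). [cite: Milne1999LefschetzClasses, §2 p. 646 L43–L50] -/
theorem range_baseChangeAction_le_centralizer :
    (baseChangeAction K A.ι).range ≤ Subalgebra.centralizer K (Set.range (baseChangeAction K A.ι)) := by
  rintro _ ⟨u, rfl⟩
  exact A.baseChangeAction_mem_centralizer_range K u

/-- **`C_K(C_K(F)) ⊆ C_K(F)`**: whatever commutes with the commutant of `F` commutes with `ι_K(K ⊗ F) ⊆ C_K(F)`.
[cite: Milne1999LefschetzClasses, §2 p. 646 L43–L50] -/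
theorem centralizer_centralizer_range_le :
    Subalgebra.centralizer K
        (↑(Subalgebra.centralizer K (Set.range (baseChangeAction K A.ι))) : Set (Module.End K (K ⊗[ℚ] V))) ≤
      Subalgebra.centralizer K (Set.range (baseChangeAction K A.ι)) :=
  Subalgebra.centralizer_le K _ _ fun _ h => A.range_baseChangeAction_le_centralizer K h

/-! ## §2 `Z(C_K(F)) = ι_K(K ⊗ F)`: the centre of `∏_𝔪 M_d(F_𝔪)` is `∏_𝔪 F_𝔪 = K ⊗ F` -/

variable [Module.Finite ℚ V]

/-- **THE CENTRE OF THE COMMUTANT OF `F` IS `F ⊗ K`: `γ ∈ Z(C_K(F)) ⟺ γ = ι_K(u)` for some `u ∈ K ⊗_ℚ F`**, for EVERY field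
`K ⊇ ℚ`. Through `Θ : C_K(F) ≅ ∏_𝔪 M_d(F_𝔪)` (g57-#5) a central `γ` becomes a central family of matrices over the fields
`F_𝔪`, hence a family of scalars `(c_𝔪 · 1)_𝔪`; by the Chinese remainder theorem `K ⊗ F → ∏_𝔪 F_𝔪` is onto, so
`(c_𝔪)_𝔪 = (ū_𝔪)_𝔪 = Θ(ι_K u)` for some `u`. («`C(A) = C₁ × ⋯ × C_t`, `Cᵢ = End_{Fᵢ}(Vᵢ) ≈ M_{2g/f}(Fᵢ)`», whose centre is
`F₁ × ⋯ × F_t = F ⊗ k`; Remark 2.3 with `E = Fᵢ`.) [cite: Milne1999LefschetzClasses, §2 p. 648 L42–L52 and Remark 2.3 p. 648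
L7–L18] -/
theorem mem_center_centralizer_range_iff
    (γ : Subalgebra.centralizer K (Set.range (baseChangeAction K A.ι))) :
    γ ∈ Subalgebra.center K (Subalgebra.centralizer K (Set.range (baseChangeAction K A.ι))) ↔
      ∃ u : K ⊗[ℚ] F, (γ : Module.End K (K ⊗[ℚ] V)) = baseChangeAction K A.ι u := by
  classical
  refine ⟨fun hγ => ?_, ?_⟩
  swap
  · rintro ⟨u, hu⟩
    have hγu : γ = ⟨baseChangeAction K A.ι u, A.baseChangeAction_mem_centralizer_range K u⟩ := Subtype.ext hu
    rw [hγu]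
    exact A.baseChangeAction_mem_center_centralizer K u
  haveI : IsArtinianRing (K ⊗[ℚ] F) := IsArtinianRing.of_finite K _
  haveI := isReduced_baseChange_numberField K F
  haveI : Fintype (MaximalSpectrum (K ⊗[ℚ] F)) := Fintype.ofFinite _
  obtain ⟨d, Θ, -, hΘ⟩ := A.exists_algEquiv_centralizer_pi_matrix_quotient K
  have hz := (mem_center_iff_map_mem_center₅₇₇ Θ γ).1 hγ
  rw [mem_center_pi_matrix_iff₅₇₇] at hz
  choose c hc using hz
  -- Chinese remainder theorem: `u ↦ (ū_𝔪)_𝔪` is onto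
  obtain ⟨u, hu⟩ := (IsArtinianRing.equivPi (K ⊗[ℚ] F)).surjective c
  refine ⟨u, ?_⟩
  have hΘu : Θ γ = Θ ⟨baseChangeAction K A.ι u, A.baseChangeAction_mem_centralizer_range K u⟩ := by
    rw [hΘ u]
    funext I
    rw [hc I, ← hu]
    rfl
  rw [Θ.injective hΘu]

/-- **`Z(C_K(F)) = ι_K(K ⊗_ℚ F)`** as subalgebras of `End_K(K ⊗ V)`: the centre of the commutant of `F` is `F ⊗ K`.
[cite: Milne1999LefschetzClasses, §2 p. 648 L42–L52 and Remark 2.3 p. 648 L7–L18] -/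
theorem map_val_center_centralizer_range_eq :
    (Subalgebra.center K (Subalgebra.centralizer K (Set.range (baseChangeAction K A.ι)))).map
        (Subalgebra.centralizer K (Set.range (baseChangeAction K A.ι))).val =
      (baseChangeAction K A.ι).range := by
  ext δ
  simp only [Subalgebra.mem_map, AlgHom.mem_range, Subalgebra.coe_val]
  constructor
  · rintro ⟨γ, hγ, rfl⟩
    obtain ⟨u, hu⟩ := (A.mem_center_centralizer_range_iff K γ).1 hγ
    exact ⟨u, hu.symm⟩
  · rintro ⟨u, rfl⟩
    exact ⟨⟨_, A.baseChangeAction_mem_centralizer_range K u⟩, A.baseChangeAction_mem_center_centralizer K u, rfl⟩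

/-! ## §3 The bicommutant `C_K(C_K(F)) = ι_K(K ⊗ F)` (double centralizer theorem for the action of `F`) -/

/-- **`δ ∈ C_K(C_K(F)) ⟺ δ = ι_K(u)` for some `u`**: an endomorphism commuting with the whole commutant of `F` lies in `C_K(F)`
and is central there. [cite: Milne1999LefschetzClasses, Remark 2.3 p. 648 L7–L18 and §2 p. 648 L42–L52] -/
theorem mem_centralizer_centralizer_range_iff (δ : Module.End K (K ⊗[ℚ] V)) :
    δ ∈ Subalgebra.centralizer K
        (↑(Subalgebra.centralizer K (Set.range (baseChangeAction K A.ι))) : Set (Module.End K (K ⊗[ℚ] V))) ↔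
      ∃ u : K ⊗[ℚ] F, δ = baseChangeAction K A.ι u := by
  constructor
  · intro hδ
    have hδC := A.centralizer_centralizer_range_le K hδ
    have hz : (⟨δ, hδC⟩ : Subalgebra.centralizer K (Set.range (baseChangeAction K A.ι))) ∈
        Subalgebra.center K (Subalgebra.centralizer K (Set.range (baseChangeAction K A.ι))) := by
      rw [Subalgebra.mem_center_iff]
      rintro ⟨γ, hγ⟩
      exact Subtype.ext ((Subalgebra.mem_centralizer_iff K).1 hδ γ hγ)
    exact (A.mem_center_centralizer_range_iff K _).1 hz
  · rintro ⟨u, rfl⟩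
    rw [Subalgebra.mem_centralizer_iff]
    intro γ hγ
    exact ((Subalgebra.mem_centralizer_iff K).1 hγ _ ⟨u, rfl⟩).symm

/-- **THE BICOMMUTANT OF `F` ON `K ⊗ V` IS `F ⊗ K`: `C_K(C_K(F)) = ι_K(K ⊗_ℚ F)`** (double centralizer theorem for the
semisimple commutative subalgebra `K ⊗ F ⊆ End_K(K ⊗ V)`), for EVERY field `K ⊇ ℚ`.
[cite: Milne1999LefschetzClasses, Remark 2.3 p. 648 L7–L18 and §2 p. 648 L42–L52] -/
theorem centralizer_centralizer_range_baseChangeAction_eq :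
    Subalgebra.centralizer K
        (↑(Subalgebra.centralizer K (Set.range (baseChangeAction K A.ι))) : Set (Module.End K (K ⊗[ℚ] V))) =
      (baseChangeAction K A.ι).range := by
  ext δ
  rw [A.mem_centralizer_centralizer_range_iff K δ, AlgHom.mem_range]
  exact exists_congr fun u => eq_comm

/-! ## §4 Dimensions (`V ≠ 0`): `dim_K ι_K(K ⊗ F) = dim_K Z(C_K(F)) = dim_K C_K(C_K(F)) = [F:ℚ]` -/

/-- **`dim_K ι_K(K ⊗_ℚ F) = [F:ℚ]`** for `V ≠ 0` (`ι_K` is injective, g56-#13 `baseChangeAction_injective`).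
[cite: Milne1999LefschetzClasses, §2 Prop. 2.1 p. 647 L14–L16] -/
theorem finrank_range_baseChangeAction_algHom [Nontrivial V] :
    Module.finrank K (baseChangeAction K A.ι).range = Module.finrank ℚ F := by
  rw [← (AlgEquiv.ofInjective _ (A.baseChangeAction_injective K)).toLinearEquiv.finrank_eq, Module.finrank_baseChange]

/-- **`dim_K Z(C_K(F)) = [F:ℚ]`** for `V ≠ 0`. [cite: Milne1999LefschetzClasses, §2 p. 648 L42–L52] -/
theorem finrank_center_centralizer_range [Nontrivial V] :
    Module.finrank K (Subalgebra.center K (Subalgebra.centralizer K (Set.range (baseChangeAction K A.ι)))) =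
      Module.finrank ℚ F := by
  rw [← A.finrank_range_baseChangeAction_algHom K, ← A.map_val_center_centralizer_range_eq K]
  exact (Subalgebra.equivMapOfInjective _ _ Subtype.val_injective).toLinearEquiv.finrank_eq

/-- **`dim_K C_K(C_K(F)) = [F:ℚ]`** for `V ≠ 0`. [cite: Milne1999LefschetzClasses, Remark 2.3 p. 648 L7–L18] -/
theorem finrank_centralizer_centralizer_range [Nontrivial V] :
    Module.finrank K (Subalgebra.centralizer K
        (↑(Subalgebra.centralizer K (Set.range (baseChangeAction K A.ι))) : Set (Module.End K (K ⊗[ℚ] V)))) =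
      Module.finrank ℚ F := by
  rw [A.centralizer_centralizer_range_baseChangeAction_eq K, A.finrank_range_baseChangeAction_algHom K]

/-! ## §5 `C_K(F) = ι_K(K ⊗ F)` exactly when `dim_F V ≤ 1` -/

/-- **`dim_ℚ V ≤ [F:ℚ] ⟹ C_K(F) = ι_K(K ⊗_ℚ F)`**: when `V` is at most one-dimensional over `F` (complex multiplication by `F`,
`d ≤ 1`) the commutant of `F` is `F ⊗ K` itself: through `Θ : C_K(F) ≅ ∏_𝔪 M_d(F_𝔪)` with `d ≤ 1` every element is a
family of scalar (`1 × 1` or empty) matrices, hence central, hence in `ι_K(K ⊗ F)` (§2).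
[cite: Milne1999LefschetzClasses, §2 p. 648 L42–L52] -/
theorem centralizer_range_eq_range_of_finrank_le (hV : Module.finrank ℚ V ≤ Module.finrank ℚ F) :
    Subalgebra.centralizer K (Set.range (baseChangeAction K A.ι)) = (baseChangeAction K A.ι).range := by
  classical
  refine le_antisymm (fun γ hγ => ?_) (A.range_baseChangeAction_le_centralizer K)
  -- it suffices that `γ` is central in `C_K(F)` (§2)
  suffices hz : (⟨γ, hγ⟩ : Subalgebra.centralizer K (Set.range (baseChangeAction K A.ι))) ∈
      Subalgebra.center K (Subalgebra.centralizer K (Set.range (baseChangeAction K A.ι))) by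
    obtain ⟨u, hu⟩ := (A.mem_center_centralizer_range_iff K _).1 hz
    exact ⟨u, hu.symm⟩
  haveI : IsArtinianRing (K ⊗[ℚ] F) := IsArtinianRing.of_finite K _
  haveI : Fintype (MaximalSpectrum (K ⊗[ℚ] F)) := Fintype.ofFinite _
  obtain ⟨d, Θ, hd, -⟩ := A.exists_algEquiv_centralizer_pi_matrix_quotient K
  -- `d ≤ 1`
  have hd1 : d ≤ 1 := by
    by_contra h
    have h2 : 2 * Module.finrank ℚ F ≤ d * Module.finrank ℚ F := Nat.mul_le_mul_right _ (by omega)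
    rw [hd] at h2
    have := Module.finrank_pos (R := ℚ) (M := F)
    omega
  rw [mem_center_iff_map_mem_center₅₇₇ Θ, mem_center_pi_matrix_iff₅₇₇]
  intro I
  -- a `d × d` matrix with `d ≤ 1` is a scalar matrix
  rcases Nat.le_one_iff_eq_zero_or_eq_one.1 hd1 with rfl | rfl
  · exact ⟨0, Subsingleton.elim _ _⟩
  · refine ⟨Θ ⟨γ, hγ⟩ I 0 0, ?_⟩
    ext i j
    obtain rfl : i = 0 := Subsingleton.elim _ _
    obtain rfl : j = 0 := Subsingleton.elim _ _
    simp [Matrix.smul_apply, Matrix.one_apply_eq]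

/-- **`C_K(F) = ι_K(K ⊗_ℚ F) ⟹ dim_ℚ V ≤ [F:ℚ]`**: if the commutant of `F` is `F ⊗ K` then `d²[F:ℚ] = dim_K C_K(F) = [F:ℚ]`,
so `d = dim_ℚ V/[F:ℚ] ≤ 1` — for an abelian variety of type I, `d = 2g/f ≥ 2` and «`C(A) ≈ M_{2g/f}`» is never `F ⊗ k`.
[cite: Milne1999LefschetzClasses, §2 p. 648 L42–L52] -/
theorem finrank_le_of_centralizer_range_eq_range
    (h : Subalgebra.centralizer K (Set.range (baseChangeAction K A.ι)) = (baseChangeAction K A.ι).range) :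
    Module.finrank ℚ V ≤ Module.finrank ℚ F := by
  rcases subsingleton_or_nontrivial V with hV0 | hV0
  · rw [Module.finrank_zero_of_subsingleton]
    exact Nat.zero_le _
  · have hdim := A.finrank_centralizer_range_baseChangeAction K
    rw [h, A.finrank_range_baseChangeAction_algHom K] at hdim
    have hd : (Module.finrank ℚ V / Module.finrank ℚ F) ^ 2 = 1 := by
      have h1 : 1 * Module.finrank ℚ F = (Module.finrank ℚ V / Module.finrank ℚ F) ^ 2 * Module.finrank ℚ F := by
        rw [one_mul]; exact hdim
      exact (mul_right_cancel₀ Module.finrank_pos.ne' h1).symm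
    rw [sq, mul_eq_one] at hd
    have hdvd := Nat.div_mul_cancel A.finrank_field_dvd_finrank
    rw [hd.1, one_mul] at hdvd
    exact hdvd.symm.le

/-- **`C_K(F) = ι_K(K ⊗_ℚ F) ⟺ dim_ℚ V ≤ [F:ℚ]`** (`⟺ d ≤ 1`): the commutant of `F` on `K ⊗ V` is `F ⊗ K` itself — equivalently
`C_K(F)` is commutative — exactly in the case of complex multiplication by `F` (or `V = 0`).
[cite: Milne1999LefschetzClasses, §2 p. 648 L42–L52] -/
theorem centralizer_range_eq_range_iff_finrank_le :
    Subalgebra.centralizer K (Set.range (baseChangeAction K A.ι)) = (baseChangeAction K A.ι).range ↔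
      Module.finrank ℚ V ≤ Module.finrank ℚ F :=
  ⟨A.finrank_le_of_centralizer_range_eq_range K, A.centralizer_range_eq_range_of_finrank_le K⟩

end EndAction

end HodgeStructure

end Literature.AlgebraicGeometry.Motives
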